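import Summits.AtomisticToContinuum.Crystallization.Theorems.SquareWellLayerCakeGapTwelveToBarlowCombinatorialLayeringTransportSteps2
import Summits.AtomisticToContinuum.Crystallization.Theorems.SquareWellLayerCakeGapTwelveToBarlowCombinatorialLayeringTransportSteps3
import Summits.AtomisticToContinuum.Crystallization.Theorems.SquareWellLayerCakeGapTwelveToBarlowCombinatorialLayeringTransportSteps4
import Summits.AtomisticToContinuum.Crystallization.Theorems.SquareWellLayerCakeGapTwelveToBarlowCombinatorialLayeringTransportSteps5
import Summits.AtomisticToContinuum.Crystallization.Theorems.SquareWellLayerCakeGapTwelveToBarlowCombinatorialLayeringTransportSteps6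
import Summits.AtomisticToContinuum.Crystallization.Theorems.PalmUnimodularRigidityShellsToBarlowChartTransportGlobalB

/-!
# Combinatorial layering (B1a of `GapTwelveToBarlow`): finite lines of frames (start of the finite development)

Crux `SquareWellLayerCake.GapTwelveToBarlow` (stmt-AtomisticToContinuum-15807), line `Sketch`,
stub `stub_combinatorialLayering`, residual `(H_develop)`.  First piece of the FINITE DEVELOPMENT
(`H_findev` of the report): the graded analogue of the 9227 lines `line_I`, `line_J`
(`…TransportGlobalB`).  On an infinite everywhere-charted `S` one iterates `I`/`I⁻¹` over all of `ℤ`;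
on graded data a valid frame of parity `+1` in the base regime at level `n + R` can be transported
`m ≤ R` steps forward or backward along `t₁` (resp. `t₂`), landing at level `n + (R − m)`, staying
valid, of parity `+1` and in the base regime, and consecutive frames are related by `I` (resp. `J`)
— forward by definition of `zIter`, backward by the inverse identity `I ∘ I⁻¹ = id`
(`Istep_IinvStep`).  Statements are indexed by `m : ℕ` with the side condition `m ≤ R` (the shape
the finite development consumes), the level arithmetic `n + (R − m) = (n + (R − (m + 1))) + 1`
being discharged by `omega`.  The chart-agnostic `zIter_natSucc`, `zIter_negSucc'` are imported
from the tree.  All `[folklore]`.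
-/

noncomputable section

namespace Summit.AtomisticToContinuum.Crystallization.Theorems.SquareWellLayerCakeGapTwelveToBarlow

open Literature.Geometry.DiscreteGeometry Literature.MathematicalPhysics.StatisticalMechanics
open Summit.AtomisticToContinuum.Crystallization.Theorems.PalmUnimodularRigidityShellsToBarlowChart hiding
  IsZChart TransportSystem scales_tied sqNormInt_transfer bond_symm nb_mem zlab_spec zlab_nb
  bond_nb_iff pattern_cases transfer_nb_nb transfer_nb_centre transfer_nb_target
  sqNormInt_zlab_centre hcp_of_mirror_pair Istep_spec Jstep_spec IinvStep_spec JinvStep_spec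
  capWithAny_of_mem_cap IinvStep_Istep Istep_IinvStep JinvStep_Jstep Jstep_JinvStep polar_at_apex
  onesided_at_apex Vstep_spec nb_inj Istep_lower Jstep_lower IinvStep_lower JinvStep_lower
  polar_at_lower_apex onesided_at_lower_apex VinvStep_spec attach_I_even attach_I_odd
  attach_lower_I_pos attach_lower_I_neg attach_J_even attach_J_odd Vstep_Istep_pt Vstep_Istep_back
  Vstep_Istep_side Vstep_Jstep_pt Vstep_Istep_comm Vstep_Jstep_comm attach_lower_J_pos
  attach_lower_J_neg VinvStep_Istep_pt VinvStep_Jstep_pt VinvStep_Istep_back VinvStep_Istep_side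
  VinvStep_Istep_comm VinvStep_Jstep_comm Istep_Jstep_comm line_I line_J adm_transports layer_zero

variable {S : ℕ → Set (EuclideanSpace ℝ (Fin 3))}
  {B : EuclideanSpace ℝ (Fin 3) → EuclideanSpace ℝ (Fin 3) → Prop}
  {Pc : EuclideanSpace ℝ (Fin 3) → Finset (Fin 3 → ℤ)}
  {nb : EuclideanSpace ℝ (Fin 3) → (Fin 3 → ℤ) → EuclideanSpace ℝ (Fin 3)}

variable
  (hch : (∀ n : ℕ, ∀ z ∈ S n, (Pc z = fcc3Int ∨ Pc z = hcpInt) ∧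
      Set.BijOn (nb z) (↑(Pc z) : Set (Fin 3 → ℤ)) {y | B z y} ∧
      ∀ t ∈ Pc z, ∀ t' ∈ Pc z, (B (nb z t) (nb z t') ↔ sqNormInt (t - t') = 18)) ∧
    (∀ n : ℕ, ∀ z ∈ S (n + 1), ∀ y, B z y → y ∈ S n) ∧
    (∀ n m : ℕ, ∀ x ∈ S n, ∀ y ∈ S m, B x y →
      ∀ (z z' : EuclideanSpace ℝ (Fin 3)) (t t' u u' : Fin 3 → ℤ),
        (t = 0 ∧ z = x ∨ t ∈ Pc x ∧ z = nb x t) → (t' = 0 ∧ z' = x ∨ t' ∈ Pc x ∧ z' = nb x t') →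
        (u = 0 ∧ z = y ∨ u ∈ Pc y ∧ z = nb y u) → (u' = 0 ∧ z' = y ∨ u' ∈ Pc y ∧ z' = nb y u') →
        sqNormInt (u - u') = sqNormInt (t - t')) ∧
    (∀ x y, B x y → B y x))

include hch


/-! ## One step forward / backward along `t₁` and `t₂` -/

/-- One `I`-step from a valid frame of parity `+1` in the base regime at level `ℓ + 1`: valid,
level `ℓ`, parity `+1`, base regime. [folklore] -/
theorem stepFin_I {ℓ : ℕ} (g : ZFrame) (hg : IsFrame (Pc g.pt) g.t₁ g.t₂ g.U) (hgS : g.pt ∈ S (ℓ + 1))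
    (hp : frameParity g.t₁ g.t₂ g.U = 1) (hA : (∀ m, ∀ z ∈ S m, Pc z = fcc3Int) ∨ Pc g.pt = hcpInt) :
    IsFrame (Pc (Istep Pc nb g).pt) (Istep Pc nb g).t₁ (Istep Pc nb g).t₂ (Istep Pc nb g).U ∧
      (Istep Pc nb g).pt ∈ S ℓ ∧ frameParity (Istep Pc nb g).t₁ (Istep Pc nb g).t₂ (Istep Pc nb g).U = 1 ∧
      ((∀ m, ∀ z ∈ S m, Pc z = fcc3Int) ∨ Pc (Istep Pc nb g).pt = hcpInt) := by
  obtain ⟨x, t₁, t₂, U⟩ := g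
  have ht₁ : t₁ ∈ Pc x := hg.2.1 (mem_hexLabels_iff.2 (Or.inl rfl))
  have hreg : Pc (nb x t₁) = fcc3Int ∨ Pc x = hcpInt ∨
      (-zlab Pc nb (nb x t₁) x ∈ Pc (nb x t₁) ∧ -zlab Pc nb (nb x t₁) (nb x t₂) ∈ Pc (nb x t₁)) := by
    rcases hA with hF | hH
    · exact Or.inl (hF _ _ (nb_mem hch hgS ht₁).1)
    · exact Or.inr (Or.inl hH)
  obtain ⟨hyS, -, -, -, -, -, -, -, -, -, htype, hframe, hpar, -⟩ := Istep_spec hch hgS hg hreg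
  refine ⟨hframe, hyS, hpar.trans hp, ?_⟩
  rcases hA with hF | hH
  · exact Or.inl hF
  · exact Or.inr (htype hH)

/-- One `I⁻¹`-step from a valid frame of parity `+1` in the base regime at level `ℓ + 1`, and the
inverse identity `I (I⁻¹ g) = g`. [folklore] -/
theorem stepFin_Iinv {ℓ : ℕ} (g : ZFrame) (hg : IsFrame (Pc g.pt) g.t₁ g.t₂ g.U) (hgS : g.pt ∈ S (ℓ + 1))
    (hp : frameParity g.t₁ g.t₂ g.U = 1) (hA : (∀ m, ∀ z ∈ S m, Pc z = fcc3Int) ∨ Pc g.pt = hcpInt) :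
    IsFrame (Pc (IinvStep Pc nb g).pt) (IinvStep Pc nb g).t₁ (IinvStep Pc nb g).t₂ (IinvStep Pc nb g).U ∧
      (IinvStep Pc nb g).pt ∈ S ℓ ∧
      frameParity (IinvStep Pc nb g).t₁ (IinvStep Pc nb g).t₂ (IinvStep Pc nb g).U = 1 ∧
      ((∀ m, ∀ z ∈ S m, Pc z = fcc3Int) ∨ Pc (IinvStep Pc nb g).pt = hcpInt) ∧
      Istep Pc nb (IinvStep Pc nb g) = g := by
  obtain ⟨x, t₁, t₂, U⟩ := g
  have hnt₁ : -t₁ ∈ Pc x := hg.2.1 (mem_hexLabels_iff.2 (Or.inr (Or.inr (Or.inr (Or.inl rfl)))))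
  have hreg : Pc (nb x (-t₁)) = fcc3Int ∨ Pc x = hcpInt ∨
      (-zlab Pc nb (nb x (-t₁)) x ∈ Pc (nb x (-t₁)) ∧
        -zlab Pc nb (nb x (-t₁)) (nb x (t₂ - t₁)) ∈ Pc (nb x (-t₁))) := by
    rcases hA with hF | hH
    · exact Or.inl (hF _ _ (nb_mem hch hgS hnt₁).1)
    · exact Or.inr (Or.inl hH)
  obtain ⟨hyS, -, -, -, -, -, -, -, -, -, htype, hframe, hpar, -⟩ := IinvStep_spec hch hgS hg hreg
  refine ⟨hframe, hyS, hpar.trans hp, ?_, Istep_IinvStep hch hgS hg hreg⟩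
  rcases hA with hF | hH
  · exact Or.inl hF
  · exact Or.inr (htype hH)

/-- One `J`-step (mirror image of `stepFin_I`). [folklore] -/
theorem stepFin_J {ℓ : ℕ} (g : ZFrame) (hg : IsFrame (Pc g.pt) g.t₁ g.t₂ g.U) (hgS : g.pt ∈ S (ℓ + 1))
    (hp : frameParity g.t₁ g.t₂ g.U = 1) (hA : (∀ m, ∀ z ∈ S m, Pc z = fcc3Int) ∨ Pc g.pt = hcpInt) :
    IsFrame (Pc (Jstep Pc nb g).pt) (Jstep Pc nb g).t₁ (Jstep Pc nb g).t₂ (Jstep Pc nb g).U ∧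
      (Jstep Pc nb g).pt ∈ S ℓ ∧ frameParity (Jstep Pc nb g).t₁ (Jstep Pc nb g).t₂ (Jstep Pc nb g).U = 1 ∧
      ((∀ m, ∀ z ∈ S m, Pc z = fcc3Int) ∨ Pc (Jstep Pc nb g).pt = hcpInt) := by
  obtain ⟨x, t₁, t₂, U⟩ := g
  have ht₂ : t₂ ∈ Pc x := hg.2.1 (mem_hexLabels_iff.2 (Or.inr (Or.inl rfl)))
  have hreg : Pc (nb x t₂) = fcc3Int ∨ Pc x = hcpInt ∨
      (-zlab Pc nb (nb x t₂) x ∈ Pc (nb x t₂) ∧ -zlab Pc nb (nb x t₂) (nb x t₁) ∈ Pc (nb x t₂)) := by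
    rcases hA with hF | hH
    · exact Or.inl (hF _ _ (nb_mem hch hgS ht₂).1)
    · exact Or.inr (Or.inl hH)
  obtain ⟨hyS, -, -, -, -, -, -, -, -, -, htype, hframe, hpar, -⟩ := Jstep_spec hch hgS hg hreg
  refine ⟨hframe, hyS, hpar.trans hp, ?_⟩
  rcases hA with hF | hH
  · exact Or.inl hF
  · exact Or.inr (htype hH)

/-- One `J⁻¹`-step and the inverse identity `J (J⁻¹ g) = g`. [folklore] -/
theorem stepFin_Jinv {ℓ : ℕ} (g : ZFrame) (hg : IsFrame (Pc g.pt) g.t₁ g.t₂ g.U) (hgS : g.pt ∈ S (ℓ + 1))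
    (hp : frameParity g.t₁ g.t₂ g.U = 1) (hA : (∀ m, ∀ z ∈ S m, Pc z = fcc3Int) ∨ Pc g.pt = hcpInt) :
    IsFrame (Pc (JinvStep Pc nb g).pt) (JinvStep Pc nb g).t₁ (JinvStep Pc nb g).t₂ (JinvStep Pc nb g).U ∧
      (JinvStep Pc nb g).pt ∈ S ℓ ∧
      frameParity (JinvStep Pc nb g).t₁ (JinvStep Pc nb g).t₂ (JinvStep Pc nb g).U = 1 ∧
      ((∀ m, ∀ z ∈ S m, Pc z = fcc3Int) ∨ Pc (JinvStep Pc nb g).pt = hcpInt) ∧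
      Jstep Pc nb (JinvStep Pc nb g) = g := by
  obtain ⟨x, t₁, t₂, U⟩ := g
  have hnt₂ : -t₂ ∈ Pc x :=
    hg.2.1 (mem_hexLabels_iff.2 (Or.inr (Or.inr (Or.inr (Or.inr (Or.inl rfl))))))
  have hreg : Pc (nb x (-t₂)) = fcc3Int ∨ Pc x = hcpInt ∨
      (-zlab Pc nb (nb x (-t₂)) x ∈ Pc (nb x (-t₂)) ∧
        -zlab Pc nb (nb x (-t₂)) (nb x (t₁ - t₂)) ∈ Pc (nb x (-t₂))) := by
    rcases hA with hF | hH
    · exact Or.inl (hF _ _ (nb_mem hch hgS hnt₂).1)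
    · exact Or.inr (Or.inl hH)
  obtain ⟨hyS, -, -, -, -, -, -, -, -, -, htype, hframe, hpar, -⟩ := JinvStep_spec hch hgS hg hreg
  refine ⟨hframe, hyS, hpar.trans hp, ?_, Jstep_JinvStep hch hgS hg hreg⟩
  rcases hA with hF | hH
  · exact Or.inl hF
  · exact Or.inr (htype hH)

/-! ## Finite lines -/

/-- **Finite `I`-line, forward half.**  From a valid frame of parity `+1` in the base regime at
level `n + R`, the `m`-fold `I`-transport (`m ≤ R`) is valid, at level `n + (R − m)`, of parity
`+1` and in the base regime (consecutive frames are related by `I` by `zIter_natSucc`).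
[folklore] -/
theorem lineFin_I_fwd {n R : ℕ} {g₀ : ZFrame} (h₀ : IsFrame (Pc g₀.pt) g₀.t₁ g₀.t₂ g₀.U)
    (h₀S : g₀.pt ∈ S (n + R)) (h₀p : frameParity g₀.t₁ g₀.t₂ g₀.U = 1)
    (h₀A : (∀ m, ∀ z ∈ S m, Pc z = fcc3Int) ∨ Pc g₀.pt = hcpInt) :
    ∀ m : ℕ, m ≤ R →
      IsFrame (Pc (zIter (Istep Pc nb) (IinvStep Pc nb) (m : ℤ) g₀).pt)
          (zIter (Istep Pc nb) (IinvStep Pc nb) (m : ℤ) g₀).t₁ (zIter (Istep Pc nb) (IinvStep Pc nb) (m : ℤ) g₀).t₂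
          (zIter (Istep Pc nb) (IinvStep Pc nb) (m : ℤ) g₀).U ∧
        (zIter (Istep Pc nb) (IinvStep Pc nb) (m : ℤ) g₀).pt ∈ S (n + (R - m)) ∧
        frameParity (zIter (Istep Pc nb) (IinvStep Pc nb) (m : ℤ) g₀).t₁
          (zIter (Istep Pc nb) (IinvStep Pc nb) (m : ℤ) g₀).t₂ (zIter (Istep Pc nb) (IinvStep Pc nb) (m : ℤ) g₀).U = 1 ∧
        ((∀ m', ∀ z ∈ S m', Pc z = fcc3Int) ∨ Pc (zIter (Istep Pc nb) (IinvStep Pc nb) (m : ℤ) g₀).pt = hcpInt) := by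
  intro m
  induction m with
  | zero =>
    intro _
    rw [Nat.sub_zero]
    exact ⟨h₀, h₀S, h₀p, h₀A⟩
  | succ m ih =>
    intro hm
    obtain ⟨h1, h2, h3, h4⟩ := ih (by omega)
    have e : zIter (Istep Pc nb) (IinvStep Pc nb) ((m + 1 : ℕ) : ℤ) g₀ =
        Istep Pc nb (zIter (Istep Pc nb) (IinvStep Pc nb) m g₀) := by
      push_cast; exact zIter_natSucc _ _ m g₀
    have el : n + (R - m) = n + (R - (m + 1)) + 1 := by omega
    rw [el] at h2
    rw [e]
    exact stepFin_I hch _ h1 h2 h3 h4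

/-- **Finite `I`-line, backward half.**  The `m`-fold `I⁻¹`-transport (`m ≤ R`) is valid, at
level `n + (R − m)`, of parity `+1`, in the base regime, and `I` undoes each backward step:
`zIter (−m) g₀ = I (zIter (−(m+1)) g₀)` whenever `m + 1 ≤ R`. [folklore] -/
theorem lineFin_I_bwd {n R : ℕ} {g₀ : ZFrame} (h₀ : IsFrame (Pc g₀.pt) g₀.t₁ g₀.t₂ g₀.U)
    (h₀S : g₀.pt ∈ S (n + R)) (h₀p : frameParity g₀.t₁ g₀.t₂ g₀.U = 1)
    (h₀A : (∀ m, ∀ z ∈ S m, Pc z = fcc3Int) ∨ Pc g₀.pt = hcpInt) :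
    ∀ m : ℕ, m ≤ R →
      (IsFrame (Pc (zIter (Istep Pc nb) (IinvStep Pc nb) (-(m : ℤ)) g₀).pt)
          (zIter (Istep Pc nb) (IinvStep Pc nb) (-(m : ℤ)) g₀).t₁
          (zIter (Istep Pc nb) (IinvStep Pc nb) (-(m : ℤ)) g₀).t₂
          (zIter (Istep Pc nb) (IinvStep Pc nb) (-(m : ℤ)) g₀).U ∧
        (zIter (Istep Pc nb) (IinvStep Pc nb) (-(m : ℤ)) g₀).pt ∈ S (n + (R - m)) ∧
        frameParity (zIter (Istep Pc nb) (IinvStep Pc nb) (-(m : ℤ)) g₀).t₁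
          (zIter (Istep Pc nb) (IinvStep Pc nb) (-(m : ℤ)) g₀).t₂
          (zIter (Istep Pc nb) (IinvStep Pc nb) (-(m : ℤ)) g₀).U = 1 ∧
        ((∀ m', ∀ z ∈ S m', Pc z = fcc3Int) ∨
          Pc (zIter (Istep Pc nb) (IinvStep Pc nb) (-(m : ℤ)) g₀).pt = hcpInt)) ∧
      (m + 1 ≤ R → zIter (Istep Pc nb) (IinvStep Pc nb) (-(m : ℤ)) g₀ =
        Istep Pc nb (zIter (Istep Pc nb) (IinvStep Pc nb) (-((m : ℤ) + 1)) g₀)) := by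
  intro m
  induction m with
  | zero =>
    intro _
    refine ⟨by simpa using ⟨h₀, h₀S, h₀p, h₀A⟩, fun hR => ?_⟩
    rw [zIter_negSucc']
    have e : zIter (Istep Pc nb) (IinvStep Pc nb) (-((0 : ℕ) : ℤ)) g₀ = g₀ := rfl
    rw [e]
    have el : n + R = n + (R - 1) + 1 := by omega
    rw [el] at h₀S
    exact ((stepFin_Iinv hch g₀ h₀ h₀S h₀p h₀A).2.2.2.2).symm
  | succ m ih =>
    intro hm
    obtain ⟨⟨h1, h2, h3, h4⟩, -⟩ := ih (by omega)
    have e : zIter (Istep Pc nb) (IinvStep Pc nb) (-((m + 1 : ℕ) : ℤ)) g₀ =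
        IinvStep Pc nb (zIter (Istep Pc nb) (IinvStep Pc nb) (-(m : ℤ)) g₀) := by
      push_cast; exact zIter_negSucc' _ _ m g₀
    have el : n + (R - m) = n + (R - (m + 1)) + 1 := by omega
    rw [el] at h2
    obtain ⟨b1, b2, b3, b4, -⟩ := stepFin_Iinv hch _ h1 h2 h3 h4
    refine ⟨by rw [e]; exact ⟨b1, b2, b3, b4⟩, fun hR => ?_⟩
    have e' : zIter (Istep Pc nb) (IinvStep Pc nb) (-(((m + 1 : ℕ) : ℤ) + 1)) g₀ =
        IinvStep Pc nb (zIter (Istep Pc nb) (IinvStep Pc nb) (-((m + 1 : ℕ) : ℤ)) g₀) :=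
      zIter_negSucc' _ _ (m + 1) g₀
    rw [e', e]
    have el' : n + (R - (m + 1)) = n + (R - (m + 2)) + 1 := by omega
    rw [el'] at b2
    exact ((stepFin_Iinv hch _ b1 b2 b3 b4).2.2.2.2).symm

/-- **Finite `J`-line, forward half** (mirror image of `lineFin_I_fwd`). [folklore] -/
theorem lineFin_J_fwd {n R : ℕ} {g₀ : ZFrame} (h₀ : IsFrame (Pc g₀.pt) g₀.t₁ g₀.t₂ g₀.U)
    (h₀S : g₀.pt ∈ S (n + R)) (h₀p : frameParity g₀.t₁ g₀.t₂ g₀.U = 1)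
    (h₀A : (∀ m, ∀ z ∈ S m, Pc z = fcc3Int) ∨ Pc g₀.pt = hcpInt) :
    ∀ m : ℕ, m ≤ R →
      IsFrame (Pc (zIter (Jstep Pc nb) (JinvStep Pc nb) (m : ℤ) g₀).pt)
          (zIter (Jstep Pc nb) (JinvStep Pc nb) (m : ℤ) g₀).t₁ (zIter (Jstep Pc nb) (JinvStep Pc nb) (m : ℤ) g₀).t₂
          (zIter (Jstep Pc nb) (JinvStep Pc nb) (m : ℤ) g₀).U ∧
        (zIter (Jstep Pc nb) (JinvStep Pc nb) (m : ℤ) g₀).pt ∈ S (n + (R - m)) ∧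
        frameParity (zIter (Jstep Pc nb) (JinvStep Pc nb) (m : ℤ) g₀).t₁
          (zIter (Jstep Pc nb) (JinvStep Pc nb) (m : ℤ) g₀).t₂ (zIter (Jstep Pc nb) (JinvStep Pc nb) (m : ℤ) g₀).U = 1 ∧
        ((∀ m', ∀ z ∈ S m', Pc z = fcc3Int) ∨ Pc (zIter (Jstep Pc nb) (JinvStep Pc nb) (m : ℤ) g₀).pt = hcpInt) := by
  intro m
  induction m with
  | zero =>
    intro _
    rw [Nat.sub_zero]
    exact ⟨h₀, h₀S, h₀p, h₀A⟩
  | succ m ih =>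
    intro hm
    obtain ⟨h1, h2, h3, h4⟩ := ih (by omega)
    have e : zIter (Jstep Pc nb) (JinvStep Pc nb) ((m + 1 : ℕ) : ℤ) g₀ =
        Jstep Pc nb (zIter (Jstep Pc nb) (JinvStep Pc nb) m g₀) := by
      push_cast; exact zIter_natSucc _ _ m g₀
    have el : n + (R - m) = n + (R - (m + 1)) + 1 := by omega
    rw [el] at h2
    rw [e]
    exact stepFin_J hch _ h1 h2 h3 h4

/-- **Finite `J`-line, backward half** (mirror image of `lineFin_I_bwd`). [folklore] -/
theorem lineFin_J_bwd {n R : ℕ} {g₀ : ZFrame} (h₀ : IsFrame (Pc g₀.pt) g₀.t₁ g₀.t₂ g₀.U)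
    (h₀S : g₀.pt ∈ S (n + R)) (h₀p : frameParity g₀.t₁ g₀.t₂ g₀.U = 1)
    (h₀A : (∀ m, ∀ z ∈ S m, Pc z = fcc3Int) ∨ Pc g₀.pt = hcpInt) :
    ∀ m : ℕ, m ≤ R →
      (IsFrame (Pc (zIter (Jstep Pc nb) (JinvStep Pc nb) (-(m : ℤ)) g₀).pt)
          (zIter (Jstep Pc nb) (JinvStep Pc nb) (-(m : ℤ)) g₀).t₁
          (zIter (Jstep Pc nb) (JinvStep Pc nb) (-(m : ℤ)) g₀).t₂
          (zIter (Jstep Pc nb) (JinvStep Pc nb) (-(m : ℤ)) g₀).U ∧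
        (zIter (Jstep Pc nb) (JinvStep Pc nb) (-(m : ℤ)) g₀).pt ∈ S (n + (R - m)) ∧
        frameParity (zIter (Jstep Pc nb) (JinvStep Pc nb) (-(m : ℤ)) g₀).t₁
          (zIter (Jstep Pc nb) (JinvStep Pc nb) (-(m : ℤ)) g₀).t₂
          (zIter (Jstep Pc nb) (JinvStep Pc nb) (-(m : ℤ)) g₀).U = 1 ∧
        ((∀ m', ∀ z ∈ S m', Pc z = fcc3Int) ∨
          Pc (zIter (Jstep Pc nb) (JinvStep Pc nb) (-(m : ℤ)) g₀).pt = hcpInt)) ∧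
      (m + 1 ≤ R → zIter (Jstep Pc nb) (JinvStep Pc nb) (-(m : ℤ)) g₀ =
        Jstep Pc nb (zIter (Jstep Pc nb) (JinvStep Pc nb) (-((m : ℤ) + 1)) g₀)) := by
  intro m
  induction m with
  | zero =>
    intro _
    refine ⟨by simpa using ⟨h₀, h₀S, h₀p, h₀A⟩, fun hR => ?_⟩
    rw [zIter_negSucc']
    have e : zIter (Jstep Pc nb) (JinvStep Pc nb) (-((0 : ℕ) : ℤ)) g₀ = g₀ := rfl
    rw [e]
    have el : n + R = n + (R - 1) + 1 := by omega
    rw [el] at h₀S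
    exact ((stepFin_Jinv hch g₀ h₀ h₀S h₀p h₀A).2.2.2.2).symm
  | succ m ih =>
    intro hm
    obtain ⟨⟨h1, h2, h3, h4⟩, -⟩ := ih (by omega)
    have e : zIter (Jstep Pc nb) (JinvStep Pc nb) (-((m + 1 : ℕ) : ℤ)) g₀ =
        JinvStep Pc nb (zIter (Jstep Pc nb) (JinvStep Pc nb) (-(m : ℤ)) g₀) := by
      push_cast; exact zIter_negSucc' _ _ m g₀
    have el : n + (R - m) = n + (R - (m + 1)) + 1 := by omega
    rw [el] at h2
    obtain ⟨b1, b2, b3, b4, -⟩ := stepFin_Jinv hch _ h1 h2 h3 h4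
    refine ⟨by rw [e]; exact ⟨b1, b2, b3, b4⟩, fun hR => ?_⟩
    have e' : zIter (Jstep Pc nb) (JinvStep Pc nb) (-(((m + 1 : ℕ) : ℤ) + 1)) g₀ =
        JinvStep Pc nb (zIter (Jstep Pc nb) (JinvStep Pc nb) (-((m + 1 : ℕ) : ℤ)) g₀) :=
      zIter_negSucc' _ _ (m + 1) g₀
    rw [e', e]
    have el' : n + (R - (m + 1)) = n + (R - (m + 2)) + 1 := by omega
    rw [el'] at b2
    exact ((stepFin_Jinv hch _ b1 b2 b3 b4).2.2.2.2).symm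

/-! ## Registered anchor (closed form) -/

omit hch in
/-- **Closed form of `stepFin_I`** (the registered anchor of this file): the section data
`S, B, Pc, nb` and the standing hypothesis written out (two hypotheses regrouped). [folklore] -/
theorem stepFin_I_graded :
    ∀ {S : ℕ → Set (EuclideanSpace ℝ (Fin 3))} {B : EuclideanSpace ℝ (Fin 3) → EuclideanSpace ℝ
    (Fin 3) → Prop} {Pc : EuclideanSpace ℝ (Fin 3) → Finset (Fin 3 → ℤ)} {nb : EuclideanSpace ℝ
    (Fin 3) → (Fin 3 → ℤ) → EuclideanSpace ℝ (Fin 3)}, ((∀ n : ℕ, ∀ z ∈ S n, (Pc z =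
    Summit.AtomisticToContinuum.Crystallization.Theorems.PalmUnimodularRigidityShellsToBarlowChart.fcc3Int
    ∨ Pc z = Literature.Geometry.DiscreteGeometry.hcpInt) ∧ Set.BijOn (nb z) (↑(Pc z) : Set (Fin
    3 → ℤ)) {y | B z y} ∧ ∀ t ∈ Pc z, ∀ t' ∈ Pc z, (B (nb z t) (nb z t') ↔
    Literature.Geometry.DiscreteGeometry.sqNormInt (t - t') = 18)) ∧ (∀ n : ℕ, ∀ z ∈ S (n + 1),
    ∀ y, B z y → y ∈ S n) ∧ (∀ n m : ℕ, ∀ x ∈ S n, ∀ y ∈ S m, B x y → ∀ (z z' : EuclideanSpace ℝ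
    (Fin 3)) (t t' u u' : Fin 3 → ℤ), (t = 0 ∧ z = x ∨ t ∈ Pc x ∧ z = nb x t) → (t' = 0 ∧ z' = x
    ∨ t' ∈ Pc x ∧ z' = nb x t') → (u = 0 ∧ z = y ∨ u ∈ Pc y ∧ z = nb y u) → (u' = 0 ∧ z' = y ∨
    u' ∈ Pc y ∧ z' = nb y u') → Literature.Geometry.DiscreteGeometry.sqNormInt (u - u') =
    Literature.Geometry.DiscreteGeometry.sqNormInt (t - t')) ∧ (∀ x y, B x y → B y x)) → ∀ {ℓ :
    ℕ} (g :
    Summit.AtomisticToContinuum.Crystallization.Theorems.PalmUnimodularRigidityShellsToBarlowChart.ZFrame),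
    g.pt ∈ S (ℓ + 1) →
    Summit.AtomisticToContinuum.Crystallization.Theorems.PalmUnimodularRigidityShellsToBarlowChart.IsFrame
    (Pc g.pt) g.t₁ g.t₂ g.U →
    Summit.AtomisticToContinuum.Crystallization.Theorems.PalmUnimodularRigidityShellsToBarlowChart.frameParity
    g.t₁ g.t₂ g.U = 1 → (∀ m, ∀ z ∈ S m, Pc z =
    Summit.AtomisticToContinuum.Crystallization.Theorems.PalmUnimodularRigidityShellsToBarlowChart.fcc3Int)
    ∨ Pc g.pt = Literature.Geometry.DiscreteGeometry.hcpInt →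
    Summit.AtomisticToContinuum.Crystallization.Theorems.PalmUnimodularRigidityShellsToBarlowChart.IsFrame
    (Pc
    (Summit.AtomisticToContinuum.Crystallization.Theorems.PalmUnimodularRigidityShellsToBarlowChart.Istep
    Pc nb g).pt)
    (Summit.AtomisticToContinuum.Crystallization.Theorems.PalmUnimodularRigidityShellsToBarlowChart.Istep
    Pc nb g).t₁
    (Summit.AtomisticToContinuum.Crystallization.Theorems.PalmUnimodularRigidityShellsToBarlowChart.Istep
    Pc nb g).t₂
    (Summit.AtomisticToContinuum.Crystallization.Theorems.PalmUnimodularRigidityShellsToBarlowChart.Istep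
    Pc nb g).U ∧
    (Summit.AtomisticToContinuum.Crystallization.Theorems.PalmUnimodularRigidityShellsToBarlowChart.Istep
    Pc nb g).pt ∈ S ℓ ∧
    Summit.AtomisticToContinuum.Crystallization.Theorems.PalmUnimodularRigidityShellsToBarlowChart.frameParity
    (Summit.AtomisticToContinuum.Crystallization.Theorems.PalmUnimodularRigidityShellsToBarlowChart.Istep
    Pc nb g).t₁
    (Summit.AtomisticToContinuum.Crystallization.Theorems.PalmUnimodularRigidityShellsToBarlowChart.Istep
    Pc nb g).t₂
    (Summit.AtomisticToContinuum.Crystallization.Theorems.PalmUnimodularRigidityShellsToBarlowChart.Istep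
    Pc nb g).U = 1 ∧ ((∀ m, ∀ z ∈ S m, Pc z =
    Summit.AtomisticToContinuum.Crystallization.Theorems.PalmUnimodularRigidityShellsToBarlowChart.fcc3Int)
    ∨ Pc
    (Summit.AtomisticToContinuum.Crystallization.Theorems.PalmUnimodularRigidityShellsToBarlowChart.Istep
    Pc nb g).pt = Literature.Geometry.DiscreteGeometry.hcpInt) := by
  intro S B Pc nb hch ℓ g hgS hg hp hA
  exact stepFin_I hch g hg hgS hp hA

end Summit.AtomisticToContinuum.Crystallization.Theorems.SquareWellLayerCakeGapTwelveToBarlow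

end
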